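import Summits.AtomisticToContinuum.BoseEinsteinCondensation.Theses.BECInsertionCorrector
import Summits.AtomisticToContinuum.BoseEinsteinCondensation.Theorems.StaticResponseBound.Negative.Basic
import Literature.MathematicalPhysics.QuantumManyBody.BoseGasStructureFactor
import Literature.MathematicalPhysics.QuantumManyBody.PeriodicBoseGasMomentumSector
import HarnessLib

/-!
# The variational principle `A ⇒ ECSF` (stub C1 of line `stable-fraction-square-completion`)

Helper file for the crux `BECInsertionCorrector.StaticResponseBound` (item
stmt-AtomisticToContinuum-12057), line `stable-fraction-square-completion`, registered stub **C1**
`stub_ecsf_of_hyperuniformity`.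

The line softens the dilute Bose gas at one mode `p = 2πk/L` by the bounded mean-field attraction
`−λ(|ρ̂_p|² − N)`, `λ = θ g_p / L³`, `g_p = 8πa + |p|²/(2ρ)`.  Stub A of the line says that, on the
phonon + crossover window, every finite-energy `δ`-near-minimiser `Φ` of the softened functional
`F(Φ) = E_Φ − λ(R_Φ − N)`, `R_Φ = ⟨|ρ̂_p|²⟩_Φ = ∫_{cell^N} |ρ̂_p|²|Φ|²`, is hyperuniform at `p`:
`R_Φ ≤ H := C_H N |p| / √(ρa)`.  This file proves the **variational principle** turning A into the
ENERGY-CONTROLLED STRUCTURE FACTOR for EVERY finite-energy state `Φ'`: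
`λ R_{Φ'} ≤ (E_{Φ'} − E₀) + λ H` with the same constants `(ρ₀, θ, C_H)`.

Proof: `F` is bounded below on finite-energy states (`E ≥ E₀`, `0 ≤ R ≤ N²` since `|ρ̂_p| ≤ N` and
`∫|Φ|² = 1`), so for `0 < ε` there is a `min(δ, ε)`-near-minimiser `Φ` (`Real.lt_sInf_add_pos`); A gives
`R_Φ ≤ H`, and `F(Φ) ≤ F(Φ') + ε`, `E_Φ ≥ E₀` give `λ R_{Φ'} ≤ E_{Φ'} − E₀ + λ H + ε`; let `ε → 0`.

Contents: `ecsf_variational_principle` (the abstract real-variable form of the argument),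
`ecsf_densityWaveSqMean_le_sq` (`⟨|ρ̂_p|²⟩_Ψ ≤ N²`), and the registered stub
`stub_ecsf_of_hyperuniformity` (statement verbatim from the checked skeleton
`Cruxes/StaticResponseBound/Lines/stable-fraction-square-completion.lean`).  No new definitions.
-/

namespace Summit.AtomisticToContinuum.BoseEinsteinCondensation.Cruxes.StaticResponseBound.StableFractionSquareCompletion

open MeasureTheory
open scoped ENNReal ComplexConjugate
open Literature.MathematicalPhysics.QuantumManyBody.BoseGas
open Summit.AtomisticToContinuum.BoseEinsteinCondensation.Theses
open Summit.AtomisticToContinuum.BoseEinsteinCondensation.Theorems.StaticResponseBound.Negative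

noncomputable section

/-- **Abstract variational principle behind C1.** On an index type `ι` with an admissibility
predicate `P`, energies `E` with a floor `E₀ ≤ E` on admissible indices, an observable `R ≤ B` on
admissible indices and a coupling `lam ≥ 0`: if every admissible `δ`-near-minimiser of the softened
functional `F i = E i - lam (R i - c)` among admissible indices has `R ≤ H`, then
`lam · R i ≤ (E i - E₀) + lam · H` for EVERY admissible `i` (pick a `min(δ, ε)`-near-minimiser `j`
of `F`, compare `F j ≤ F i + ε`, use `E₀ ≤ E j`, `R j ≤ H`, and let `ε → 0`). [folklore] -/
theorem ecsf_variational_principle {ι : Type*} (P : ι → Prop) (E R : ι → ℝ)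
    {lam c E₀ H B δ : ℝ} (hlam : 0 ≤ lam) (hδ : 0 < δ)
    (hE₀ : ∀ i, P i → E₀ ≤ E i) (hR : ∀ i, P i → R i ≤ B)
    (hnear : ∀ i, (P i ∧ ∀ j, P j → E i - lam * (R i - c) ≤ E j - lam * (R j - c) + δ) → R i ≤ H)
    (i : ι) (hi : P i) : lam * R i ≤ E i - E₀ + lam * H := by
  -- the softened energies of the admissible indices
  set S : Set ℝ := (fun j => E j - lam * (R j - c)) '' {j | P j} with hS
  have hne : S.Nonempty := ⟨_, i, hi, rfl⟩
  have hbdd : BddBelow S := by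
    refine ⟨E₀ - lam * (B - c), ?_⟩
    rintro _ ⟨j, hj, rfl⟩
    have h1 := hE₀ j hj
    have h2 : lam * (R j - c) ≤ lam * (B - c) :=
      mul_le_mul_of_nonneg_left (sub_le_sub_right (hR j hj) c) hlam
    show E₀ - lam * (B - c) ≤ E j - lam * (R j - c)
    linarith
  refine le_of_forall_pos_le_add fun ε hε => ?_
  obtain ⟨_, ⟨j, hj, rfl⟩, hjlt⟩ := Real.lt_sInf_add_pos hne (lt_min hδ hε)
  -- `j` is an admissible `δ`-near-minimiser, hence `R j ≤ H`
  have hRj : R j ≤ H := by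
    refine hnear j ⟨hj, fun j' hj' => ?_⟩
    have h1 : sInf S ≤ E j' - lam * (R j' - c) := csInf_le hbdd ⟨j', hj', rfl⟩
    have h2 := min_le_left δ ε
    linarith
  have hFi : sInf S ≤ E i - lam * (R i - c) := csInf_le hbdd ⟨i, hi, rfl⟩
  have h3 := min_le_right δ ε
  have h4 : lam * R j ≤ lam * H := mul_le_mul_of_nonneg_left hRj hlam
  have h5 := hE₀ j hj
  have key : E j - lam * (R j - c) ≤ E i - lam * (R i - c) + ε := by linarith
  rw [mul_sub, mul_sub] at key
  linarith

/-- `⟨|ρ̂_k|²⟩_Ψ ≤ N²` for a normalised periodic state: `|ρ̂_k| ≤ N` pointwise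
(`norm_densityWave_le`) and `∫_{cell^N} |Ψ|² = 1` (`integral_norm_sq_eq_one`). [folklore] -/
theorem ecsf_densityWaveSqMean_le_sq {N : ℕ} {L : ℝ} (k : Fin 3 → ℤ) (Ψ : PeriodicTrialState N L) :
    ∫ X in cellN N L, ‖densityWave N L k X‖ ^ 2 * ‖Ψ.ψ X‖ ^ 2 ≤ (N : ℝ) ^ 2 := by
  have hint : Integrable (fun X => (N : ℝ) ^ 2 * ‖Ψ.ψ X‖ ^ 2) (volume.restrict (cellN N L)) :=
    (integrableOn_cellN ((Ψ.contDiff.continuous.norm).pow 2) L).const_mul _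
  calc ∫ X in cellN N L, ‖densityWave N L k X‖ ^ 2 * ‖Ψ.ψ X‖ ^ 2
      ≤ ∫ X in cellN N L, (N : ℝ) ^ 2 * ‖Ψ.ψ X‖ ^ 2 :=
        integral_mono_of_nonneg (Filter.Eventually.of_forall fun X => by positivity) hint
          (Filter.Eventually.of_forall fun X =>
            mul_le_mul_of_nonneg_right
              (pow_le_pow_left₀ (norm_nonneg _) (norm_densityWave_le L k X) 2) (sq_nonneg _))
    _ = (N : ℝ) ^ 2 := by rw [integral_const_mul, integral_norm_sq_eq_one, mul_one]

/-- **C1 (S)** `stub_ecsf_of_hyperuniformity` — the variational principle: softened-mode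
hyperuniformity of near-minimisers (stub A of the line, the hypothesis, with `IsSoftenedNearMin`,
`softenedEnergy`, `vertex`, `densityWaveSqMean` unfolded) implies the energy-controlled structure
factor `(θg_p/L³)⟨|ρ̂_p|²⟩_Φ ≤ (E_Φ − E₀) + (θg_p/L³)·C_H N|p|/√(ρa)` for EVERY finite-energy periodic
state `Φ` on the window `|p|² ≤ M₀²ρa`, with the same constants `(ρ₀, θ, C_H)`.  Proof: fix a
finite-energy `Φ`; the softened functional is bounded below on finite-energy states (`E ≥ E₀`,
`⟨|ρ̂_p|²⟩ ≤ N²`), so for `0 < ε` there is a `min(δ, ε)`-near-minimiser, to which A applies; compare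
and let `ε → 0` (`ecsf_variational_principle`). [folklore] -/
theorem stub_ecsf_of_hyperuniformity :
    (∀ v : ℝ → ℝ≥0∞, IsRepulsiveFiniteRange v → ∀ M₀ : ℝ, 0 < M₀ →
      ∃ ρ₀ : ℝ, 0 < ρ₀ ∧ ∃ θ : ℝ, 0 < θ ∧ ∃ C_H : ℝ, 0 ≤ C_H ∧
        ∀ ρ : ℝ, 0 < ρ → ρ < ρ₀ → ∀ N : ℕ, 0 < N → ∀ k : Fin 3 → ℤ, k ≠ 0 →
          psq (sideLength ρ N) k ≤ M₀ ^ 2 * (ρ * (scatteringLength v).toReal) →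
          ∃ δ : ℝ, 0 < δ ∧ ∀ Φ : PeriodicTrialState N (sideLength ρ N),
            (periodicEnergy v Φ ≠ ⊤ ∧
              ∀ Φ' : PeriodicTrialState N (sideLength ρ N), periodicEnergy v Φ' ≠ ⊤ →
                (periodicEnergy v Φ).toReal -
                    θ * (8 * Real.pi * (scatteringLength v).toReal +
                        psq (sideLength ρ N) k / (2 * ρ)) / sideLength ρ N ^ 3 *
                      ((∫ X in cellN N (sideLength ρ N),
                          ‖densityWave N (sideLength ρ N) k X‖ ^ 2 * ‖Φ.ψ X‖ ^ 2) - N) ≤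
                  (periodicEnergy v Φ').toReal -
                    θ * (8 * Real.pi * (scatteringLength v).toReal +
                        psq (sideLength ρ N) k / (2 * ρ)) / sideLength ρ N ^ 3 *
                      ((∫ X in cellN N (sideLength ρ N),
                          ‖densityWave N (sideLength ρ N) k X‖ ^ 2 * ‖Φ'.ψ X‖ ^ 2) - N) + δ) →
            (∫ X in cellN N (sideLength ρ N),
                ‖densityWave N (sideLength ρ N) k X‖ ^ 2 * ‖Φ.ψ X‖ ^ 2) ≤
              C_H * N * Real.sqrt (psq (sideLength ρ N) k) /
                Real.sqrt (ρ * (scatteringLength v).toReal)) →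
    ∀ v : ℝ → ℝ≥0∞, IsRepulsiveFiniteRange v → ∀ M₀ : ℝ, 0 < M₀ →
      ∃ ρ₀ : ℝ, 0 < ρ₀ ∧ ∃ θ : ℝ, 0 < θ ∧ ∃ C_H : ℝ, 0 ≤ C_H ∧
        ∀ ρ : ℝ, 0 < ρ → ρ < ρ₀ → ∀ N : ℕ, 0 < N → ∀ k : Fin 3 → ℤ, k ≠ 0 →
          psq (sideLength ρ N) k ≤ M₀ ^ 2 * (ρ * (scatteringLength v).toReal) →
          ∀ Φ : PeriodicTrialState N (sideLength ρ N), periodicEnergy v Φ ≠ ⊤ →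
            θ * (8 * Real.pi * (scatteringLength v).toReal + psq (sideLength ρ N) k / (2 * ρ)) /
                sideLength ρ N ^ 3 *
                (∫ X in cellN N (sideLength ρ N),
                  ‖densityWave N (sideLength ρ N) k X‖ ^ 2 * ‖Φ.ψ X‖ ^ 2) ≤
              (periodicEnergy v Φ).toReal - (periodicGroundStateEnergy v N (sideLength ρ N)).toReal +
                θ * (8 * Real.pi * (scatteringLength v).toReal + psq (sideLength ρ N) k / (2 * ρ)) /
                  sideLength ρ N ^ 3 *
                  (C_H * N * Real.sqrt (psq (sideLength ρ N) k) /
                    Real.sqrt (ρ * (scatteringLength v).toReal)) := by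
  intro hA v hv M₀ hM₀
  obtain ⟨ρ₀, hρ₀, θ, hθ, C_H, hC_H, hwin⟩ := hA v hv M₀ hM₀
  refine ⟨ρ₀, hρ₀, θ, hθ, C_H, hC_H, ?_⟩
  intro ρ hρ hρlt N hN k hk hwindow Φ hΦ
  obtain ⟨δ, hδ, hnear⟩ := hwin ρ hρ hρlt N hN k hk hwindow
  have hL : 0 < sideLength ρ N := sideLength_pos hρ hN
  have hpsq : 0 ≤ psq (sideLength ρ N) k := psq_nonneg _ _
  have hlam : 0 ≤ θ * (8 * Real.pi * (scatteringLength v).toReal +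
      psq (sideLength ρ N) k / (2 * ρ)) / sideLength ρ N ^ 3 := by
    positivity
  exact ecsf_variational_principle
    (P := fun Ψ : PeriodicTrialState N (sideLength ρ N) => periodicEnergy v Ψ ≠ ⊤)
    (E := fun Ψ : PeriodicTrialState N (sideLength ρ N) => (periodicEnergy v Ψ).toReal)
    (R := fun Ψ : PeriodicTrialState N (sideLength ρ N) =>
      ∫ X in cellN N (sideLength ρ N), ‖densityWave N (sideLength ρ N) k X‖ ^ 2 * ‖Ψ.ψ X‖ ^ 2)
    (c := (N : ℝ)) (E₀ := (periodicGroundStateEnergy v N (sideLength ρ N)).toReal)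
    (H := C_H * N * Real.sqrt (psq (sideLength ρ N) k) /
      Real.sqrt (ρ * (scatteringLength v).toReal))
    (B := (N : ℝ) ^ 2) hlam hδ
    (fun Ψ hΨ => ENNReal.toReal_mono hΨ (periodicGroundStateEnergy_le v Ψ))
    (fun Ψ _ => ecsf_densityWaveSqMean_le_sq k Ψ) hnear Φ hΦ

end

end Summit.AtomisticToContinuum.BoseEinsteinCondensation.Cruxes.StaticResponseBound.StableFractionSquareCompletion
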